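import Mathlib
import Summits.Ventures.PercRepro2.Defs
import Summits.Ventures.PercRepro2.Independence
import Summits.Ventures.PercRepro2.Harris
import Summits.Ventures.PercRepro2.Graph
import Summits.Ventures.PercRepro2.Exploration
import Summits.Ventures.PercRepro2.Events
import Summits.Ventures.PercRepro2.Induced

/-!
# Row 2′CON-W, statement of record: the GATE (blind cell PercRepro2, typer-1; mine-c g6
MINE-C.md v3.0 §13.6, INBOX 2026-08-23T16:22:05Z "ONE STATEMENT SUBSUMES THE WHOLE (CC-T⁻) LINE";
lead g11 16:22:43Z "(GATE A,B) recorded in row 2′CON-W as the candidate statement of record";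
16:30:35Z "typer-1: `Gate.gateEvent`/`GateRow`")

Root `s`, avoided set `T`, `S = C(s)`, `K = hull(T) = ⋃_{t ∈ T} C(t)`, `R_T = {s ↮ T}`, markers `a, b`
with the cluster events `X = {a ∈ S}`, `Y = {b ∈ S}` and the centring `m_T = E[· | R_T]`. For
`A, B ⊆ V ∖ (T ∪ {s})` (any sizes, any overlap) the **gate event** is

  `gateEvent A B = R_T ∖ {S ∩ A ≠ ∅ ∧ K ∩ B ≠ ∅}`

(one new gadget vertex entered from `B` and exited to `A` would connect `s` to `T` exactly on the
removed class), and the row is `Φ(gateEvent A B) ≥ 0`, `Φ(E) = E[(X − m_T)(Y − m_T); E]`, cleared by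
`P(R_T)²`:

* **`GateRow`** `P(R_T)² P(XY; G) − P(R_T) [P(X; R_T) P(Y; G) + P(Y; R_T) P(X; G)] + P(X; R_T) P(Y; R_T) P(G) ≥ 0`,
  `G = gateEvent A B`;
* `A = B = {u, w}` is (CC-T⁻) (`CCTLin.CCTMinus`, via `PASub.Rplus`); `A = B = W` is (CON-W)
  (`Contract.ConW`, via `Contract.avoidAll_contract_eq`); `A = {u}, B = {w}` is the directed-arc
  rung (ARC u ⇐ w); `A ∩ B = ∅` a one-way gate; `A = {u, v}, B = {v, w}` the 3-chain.
* **`GateRow_all`**: over all finite graphs, admissible weights, `s ∉ T`, `A, B ⊆ V ∖ (T ∪ {s})`.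

Census (mine-c, C long double, every negative re-checked exactly): `n = 6` ALL 112 graphs × 12
vectors, every root, `|T| ≤ 2`, ALL `(A, B)` with `|A|, |B| ≤ 3` incl. overlaps, every pair:
`|A ∪ B| = 2` 0 / 15,240,960, `= 3` 0 / 30,240,000, `= 4` 0 / 12,096,000; (ARC) `n = 7` ALL 853 × 3
vectors 0 / 40,841,640. Boundary: arc sets that are not gates fail (two disjoint arcs, the directed
2-path, the 3-cycle, towers with ≥ 3 levels), CONTAINMENT variants fail at `n = 5` — the statement
is about HITTING events. First theorem of the row beyond the s/T-edge cases: the MARKER GATE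
`GateRow s T a b {a} B` (mine-c §13.8; Lean: `GateRow_marker`, next file).
-/

namespace Summit.Ventures.PercRepro2

namespace Gate

variable {V : Type*} {E : Type*}

section Event

variable (ends : E → Sym2 V) (s : V) (T : Finset V)

/-- `{S ∩ A ≠ ∅}`: the cluster of the root hits `A`. -/
def hitsS (A : Finset V) : Set (Config E) := {ω | ∃ u ∈ A, Conn ends ω s u}

/-- `{K ∩ B ≠ ∅}`: the hull of `T` (the union of the clusters of `T`) hits `B`. -/
def hitsK (B : Finset V) : Set (Config E) := {ω | ∃ w ∈ B, ∃ t ∈ T, Conn ends ω t w}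

/-- **The gate event** `R_T ∖ {S hits A ∧ K hits B}` (mine-c §13.6). -/
def gateEvent (A B : Finset V) : Set (Config E) :=
  avoidAll ends s T ∩ (hitsS ends s A ∩ hitsK ends T B)ᶜ

/-- Membership in the gate event. -/
lemma mem_gateEvent {A B : Finset V} {ω : Config E} :
    ω ∈ gateEvent ends s T A B ↔
      ω ∈ avoidAll ends s T ∧ ¬ (ω ∈ hitsS ends s A ∧ ω ∈ hitsK ends T B) := Iff.rfl

/-- The gate event is contained in `R_T`. -/
lemma gateEvent_subset (A B : Finset V) : gateEvent ends s T A B ⊆ avoidAll ends s T :=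
  Set.inter_subset_left

/-- With `A = ∅` (or `B = ∅`) the gate is all of `R_T`. -/
lemma gateEvent_empty_left (B : Finset V) : gateEvent ends s T ∅ B = avoidAll ends s T := by
  ext ω
  simp [gateEvent, hitsS]

/-- With `B = ∅` the gate is all of `R_T`. -/
lemma gateEvent_empty_right (A : Finset V) : gateEvent ends s T A ∅ = avoidAll ends s T := by
  ext ω
  simp [gateEvent, hitsK]

/-- Gates are antitone in `A` (a smaller exit set removes less). -/
lemma gateEvent_anti_left {A A' : Finset V} (h : A ⊆ A') (B : Finset V) :
    gateEvent ends s T A' B ⊆ gateEvent ends s T A B := by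
  intro ω ⟨hR, hno⟩
  refine ⟨hR, fun ⟨⟨u, hu, hc⟩, hK⟩ => hno ⟨⟨u, h hu, hc⟩, hK⟩⟩

/-- Gates are antitone in `B`. -/
lemma gateEvent_anti_right (A : Finset V) {B B' : Finset V} (h : B ⊆ B') :
    gateEvent ends s T A B' ⊆ gateEvent ends s T A B := by
  intro ω ⟨hR, hno⟩
  refine ⟨hR, fun ⟨hS, ⟨w, hw, t, ht, hc⟩⟩ => hno ⟨hS, ⟨w, h hw, t, ht, hc⟩⟩⟩

end Event

section Row

variable [Fintype E] [DecidableEq E] [DecidableEq V] {R : Type*} [Field R] [LinearOrder R]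

variable (p : E → R) (ends : E → Sym2 V) (s : V) (T : Finset V) (a b : V) (A B : Finset V)

/-- **(GATE A,B)** (mine-c §13.6), cleared by `P(R_T)²`: `Φ(gateEvent A B) ≥ 0` with
`Φ(E) = E[(X − m_T)(Y − m_T); E]`, `X = {a ∈ C(s)}`, `Y = {b ∈ C(s)}`, `m_T = E[· | R_T]`. -/
def GateRow : Prop :=
  0 ≤ prob p (avoidAll ends s T) ^ 2 *
        prob p (connAll ends s ({a} ∪ {b}) ∩ gateEvent ends s T A B) -
      prob p (avoidAll ends s T) *
        (prob p (connAll ends s {a} ∩ avoidAll ends s T) *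
            prob p (connAll ends s {b} ∩ gateEvent ends s T A B) +
          prob p (connAll ends s {b} ∩ avoidAll ends s T) *
            prob p (connAll ends s {a} ∩ gateEvent ends s T A B)) +
      prob p (connAll ends s {a} ∩ avoidAll ends s T) *
        prob p (connAll ends s {b} ∩ avoidAll ends s T) * prob p (gateEvent ends s T A B)

end Row

section Closure

variable (R : Type*) [Field R] [LinearOrder R] [IsStrictOrderedRing R]

/-- **Row 2′CON-W, statement of record**: (GATE A,B) over all finite graphs, admissible weights,
roots `s ∉ T`, gate sets `A, B ⊆ V ∖ (T ∪ {s})` and markers `a, b`. -/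
def GateRow_all : Prop :=
  ∀ (V E : Type) [Fintype V] [DecidableEq V] [Fintype E] [DecidableEq E]
    (ends : E → Sym2 V) (p : E → R), IsProbVec p →
    ∀ (s : V) (T : Finset V) (a b : V) (A B : Finset V), s ∉ T →
      (∀ u ∈ A, u ∉ T ∧ u ≠ s) → (∀ w ∈ B, w ∉ T ∧ w ≠ s) → GateRow p ends s T a b A B

end Closure

end Gate

end Summit.Ventures.PercRepro2
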